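import Summits.AtomisticToContinuum.HydrodynamicLimit.Theorems.AntiMazurCoboundariesInfluenceLocalityObjects
import Literature.MathematicalPhysics.KineticTheory.BackwardClusterMeasurable

/-!
# Prelim of stub `stub_forecastCapsExist` (line `true-anchored-infection`, crux `InfluenceLocality`,
# stmt-AtomisticToContinuum-13916; route AntiMazurCoboundaries): the gathering event is measurable
# and reduces to a grid-free backward-cluster cardinality event

STUB 5 of the line (`ForecastCapsExist`, the `G_free` residual) asks for an admissible threshold
schedule `M(R)` whose GATHERING event `IsGathering σ T R N Ψ (M R) · i` — some particle `m` of the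
forecast world of `i` has, at some rational grid time `Tℓq`, `q ∈ [0, 1]`, a backward cluster
(`KineticTheory.backwardCluster` along the forecast trajectory, window `(0, Tℓq]`) with more than
`M(R)` members counting `m` — has `G_N`-probability `→ 0` as `R → ∞`. This file does NOT prove the
stub (a cluster-cardinality tail of Pulvirenti–Simonella type for an isolated Gibbs cluster of
`≍ R³` spheres released into vacuum, in print only in the Boltzmann–Grad limit). It proves the
deterministic and measure-theoretic bookkeeping around it:

* § 1 (any curve / hard-sphere trajectory / flow) the backward cluster GROWS WITH THE FINAL TIME of
  its window (`backwardCluster_mono_right`: the sweep from the later time reaches the earlier one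
  with a running cluster containing the tagged particle, and the sweep is monotone in its initial
  cluster, `sweep_fst_mono`), and `|{i} ∪ BC(i)| ≤ #collisions in the window + 1`
  (`card_insert_backwardCluster_le`, from `IsHardSphereTrajectory.card_add_recollisionCount_le`);
* § 2 the events `ForecastGood` (the range cluster of `i` restricts to a good datum of its cluster
  flow) and `IsCrowded` (grid-free, flow version: some forecast particle has a backward cluster of
  `≥ M` members over the WHOLE window `(0, Tℓ]`), and ON `ForecastGood`, for `0 ≤ T`,
  `IsGathering ↔ IsCrowded` (`isGathering_iff_isCrowded`: the rational grid is superfluous by § 1)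
  and `IsGathering → M ≤ #collisions of the forecast world in (0, Tℓ]`
  (`collisions_of_isGathering`);
* § 3 measurability: `{ForecastGood}`, `{IsCrowded}` and `{ForecastGood ∧ IsGathering}` are
  measurable (`HardSphereFlow.measurableSet_backwardCluster_eq` on each slice
  `{rangeCluster = S}`, `measurableSet_rangeCluster_eq`, countable union over `S`, `m`, `q`), hence
  `{IsGathering}` is null-measurable under any law charging no bad forecast
  (`nullMeasurableSet_isGathering`), and the REDUCTION
  `μ {IsGathering} ≤ μ {¬ ForecastGood} + μ {IsCrowded}` for `0 ≤ T` and every law `μ` (the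
  registered prelim `stub_forecastCapsExist_prelim`);
* § 4 the remaining goal as a definition, `ForecastClusterCardTail` (the same `η/R₀/N₀` shell as
  `ForecastGatheringTail` with the event `IsCrowded`), its transfer to `ForecastGatheringTail`
  given that bad forecasts are `G_N`-null (`forecastGatheringTail_of_clusterCardTail`), and an
  admissible schedule builder (`admissibleGathering_floor`).

Caveat recorded for the lead (numbers): the total-collision reduction of § 2 cannot close the stub —
a released cluster of `k ≈ 4.2 R³` spheres at reduced density `σ` makes `≈ 2√π k T σ² √θ` pair
collisions within `Tℓ` on average (dilute-gas rate), which exceeds every admissible threshold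
`M(R) ≤ √R` as `R → ∞`; only the per-particle cardinality event `IsCrowded` is of the right size.
-/

namespace Summit.AtomisticToContinuum.HydrodynamicLimit.Theorems.TrueAnchoredInfection

open MeasureTheory Set
open scoped ENNReal
open Literature.Analysis.FluidPDE Literature.MathematicalPhysics.KineticTheory

noncomputable section

/-! ## § 1 Backward clusters grow with the final time of the window -/

section General

variable {d : Type*} [Fintype d] {X : Type*} {k : ℕ}

/-- The backward step is monotone in the running cluster. -/
theorem clusterStep_mono (E : Finset (Sym2 (Fin k))) {S S' : Finset (Fin k)} (h : S ⊆ S') :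
    clusterStep E S ⊆ clusterStep E S' := by
  intro x hx
  rcases mem_clusterStep.1 hx with hx | ⟨j, hj, hjx⟩
  · exact mem_clusterStep.2 (Or.inl (h hx))
  · exact mem_clusterStep.2 (Or.inr ⟨j, h hj, hjx⟩)

/-- The running cluster of a sweep is monotone in the initial cluster. -/
theorem sweep_fst_mono (Es : List (Finset (Sym2 (Fin k)))) {p p' : Finset (Fin k) × ℕ}
    (h : p.1 ⊆ p'.1) : (sweep Es p).1 ⊆ (sweep Es p').1 := by
  induction Es with
  | nil => exact h
  | cons E Es ih =>
    rw [sweep_cons, sweep_cons]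
    exact clusterStep_mono E ih

variable {G : Geometry d X} {ε : ℝ} {γ : ℝ → Config k d X} {i : Fin k} {s t t' : ℝ}

/-- **The backward cluster grows with the final time**: for `t ≤ t'` (and finitely many collision
times in `(s, t']`), `BC(i; (s, t]) ⊆ BC(i; (s, t'])` — the sweep from `t'` reaches time `t` with a
running cluster containing `i`, and sweeping `(s, t]` is monotone in the initial cluster. -/
theorem backwardCluster_mono_right (htt' : t ≤ t')
    (hfin : (collisionTimes G ε γ ∩ Ioc s t').Finite) :
    backwardCluster G ε γ i s t ⊆ backwardCluster G ε γ i s t' := by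
  rcases le_or_gt s t with hst | hts
  · intro x hx
    rw [mem_backwardCluster_iff] at hx ⊢
    refine ⟨hx.1, ?_⟩
    rw [backwardSweep_eq_sweep hst htt' hfin]
    have h0 : (({i}, 0) : Finset (Fin k) × ℕ).1 ⊆ (backwardSweep G ε γ i t t').1 :=
      Finset.singleton_subset_iff.2 mem_backwardSweep_fst_self
    exact sweep_fst_mono (collisionEvents G ε γ s t) h0 hx.2
  · rw [backwardCluster_of_le hts.le]
    exact Finset.empty_subset _

/-- The number of collision times in the window grows with its final time. -/
theorem card_collisionWindow_mono_right (htt' : t ≤ t')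
    (hfin : (collisionTimes G ε γ ∩ Ioc s t').Finite) :
    (collisionWindow G ε γ s t).card ≤ (collisionWindow G ε γ s t').card := by
  rcases le_or_gt s t with hst | hts
  · rw [collisionWindow_eq_union hst htt' hfin]
    exact Finset.card_le_card Finset.subset_union_left
  · rw [collisionWindow_eq_empty_of_le hts.le, Finset.card_empty]
    exact Nat.zero_le _

/-- Counting the tagged particle: `|{i} ∪ BC(i)| = |BC(i)| + 1`. -/
theorem card_insert_backwardCluster :
    (insert i (backwardCluster G ε γ i s t)).card = (backwardCluster G ε γ i s t).card + 1 :=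
  Finset.card_insert_of_notMem not_mem_backwardCluster_self

variable [TopologicalSpace X]

/-- A hard-sphere trajectory has finitely many collision times in every window `(s, t]`. -/
theorem finite_collisionTimes_inter_Ioc (h : IsHardSphereTrajectory G ε k γ) (s t : ℝ) :
    (collisionTimes G ε γ ∩ Ioc s t).Finite :=
  (h.locFinite s t).subset (inter_subset_inter_right _ Ioc_subset_Icc_self)

/-- Along a hard-sphere trajectory the backward cluster grows with the final time. -/
theorem backwardCluster_mono_right_of_isTrajectory (h : IsHardSphereTrajectory G ε k γ)
    (htt' : t ≤ t') : backwardCluster G ε γ i s t ⊆ backwardCluster G ε γ i s t' :=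
  backwardCluster_mono_right htt' (finite_collisionTimes_inter_Ioc h s t')

/-- **The tagged particle and its backward cluster are at most the collisions plus one**: along a
hard-sphere trajectory `|{i} ∪ BC(i; (s, t])| ≤ #(collision times in (s, t]) + 1` (creations plus
recollisions are collisions, `IsHardSphereTrajectory.card_add_recollisionCount_le`). -/
theorem card_insert_backwardCluster_le (h : IsHardSphereTrajectory G ε k γ) :
    (insert i (backwardCluster G ε γ i s t)).card ≤ (collisionWindow G ε γ s t).card + 1 := by
  rw [card_insert_backwardCluster]
  have := h.card_add_recollisionCount_le (i := i) (s := s) (t := t)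
  omega

variable [MeasureSpace X]

/-- Along a hard-sphere flow the backward cluster (flow version, junk `∅` off the good set) grows
with the final time. -/
theorem flow_backwardCluster_mono_right (Φ : HardSphereFlow G ε k) {z : Config k d X}
    (htt' : t ≤ t') : Φ.backwardCluster i s t z ⊆ Φ.backwardCluster i s t' z := by
  by_cases hz : z ∈ Φ.good
  · rw [Φ.backwardCluster_apply hz, Φ.backwardCluster_apply hz]
    exact backwardCluster_mono_right_of_isTrajectory (Φ.isTrajectory z hz) htt'
  · rw [Φ.backwardCluster_apply_of_not_mem hz]
    exact Finset.empty_subset _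

/-- Every predicate of the backward cluster along a flow cuts out a measurable set of initial data
(`HardSphereFlow.measurableSet_backwardCluster_eq`, finitely many values). -/
theorem measurableSet_backwardCluster_pred (Φ : HardSphereFlow G ε k) (i : Fin k) (s t : ℝ)
    (P : Finset (Fin k) → Prop) : MeasurableSet {z | P (Φ.backwardCluster i s t z)} := by
  have : {z | P (Φ.backwardCluster i s t z)} =
      ⋃ A ∈ {A : Finset (Fin k) | P A}, {z | Φ.backwardCluster i s t z = A} := by
    ext z
    simp
  rw [this]
  exact MeasurableSet.biUnion (Set.to_countable _)
    fun A _ => Φ.measurableSet_backwardCluster_eq i s t A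

end General

/-! ## § 2 The good-forecast and crowding events; the grid is superfluous -/

/-- GOOD FORECAST: the range cluster of `i` at range `Rℓ` restricts to a good datum of its cluster
flow, so that the forecast world of `i` is a genuine hard-sphere trajectory (`G_N`-almost sure,
stub `stub_forecastWorldsGood` of the line). -/
def ForecastGood (σ R : ℝ) (N : ℕ) (Ψ : ClusterFlows σ N) (z : Phase N) (i : Fin (N + 1)) : Prop :=
  Config.restrictTo (rangeCluster G3 (R * ell N) z i) z ∈
    (Ψ (rangeCluster G3 (R * ell N) z i).card).good

/-- CROWDING (grid-free, flow version): some particle `m` of the forecast world of `i` has a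
backward cluster of at least `M` members over the whole window `(0, Tℓ]`
(`HardSphereFlow.backwardCluster`, junk `∅` off the good set of the cluster flow). -/
def IsCrowded (σ T R : ℝ) (N : ℕ) (Ψ : ClusterFlows σ N) (M : ℕ) (z : Phase N)
    (i : Fin (N + 1)) : Prop :=
  ∃ m : Fin (rangeCluster G3 (R * ell N) z i).card,
    M ≤ ((Ψ (rangeCluster G3 (R * ell N) z i).card).backwardCluster m 0 (T * ell N)
      (Config.restrictTo (rangeCluster G3 (R * ell N) z i) z)).card

variable {σ T R : ℝ} {N : ℕ} {Ψ : ClusterFlows σ N} {M : ℕ} {z : Phase N} {i : Fin (N + 1)}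

/-- On a good forecast the backward clusters of the forecast world are the flow versions. -/
theorem backwardCluster_forecastWorld (hz : ForecastGood σ R N Ψ z i)
    (m : Fin (rangeCluster G3 (R * ell N) z i).card) (s t : ℝ) :
    backwardCluster G3 (hsDiameter σ N) (forecastWorld σ R N Ψ z i) m s t =
      (Ψ (rangeCluster G3 (R * ell N) z i).card).backwardCluster m s t
        (Config.restrictTo (rangeCluster G3 (R * ell N) z i) z) :=
  ((Ψ _).backwardCluster_apply hz).symm

/-- On a good forecast the forecast world is a hard-sphere trajectory. -/
theorem isHardSphereTrajectory_forecastWorld (hz : ForecastGood σ R N Ψ z i) :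
    IsHardSphereTrajectory G3 (hsDiameter σ N) (rangeCluster G3 (R * ell N) z i).card
      (forecastWorld σ R N Ψ z i) :=
  (Ψ _).isTrajectory _ hz

/-- Grid times lie in the window: `Tℓq ≤ Tℓ` for `q ≤ 1` and `0 ≤ T`. -/
theorem grid_le (hT : 0 ≤ T) (N : ℕ) {q : ℚ} (hq : q ≤ 1) : T * ell N * q ≤ T * ell N :=
  mul_le_of_le_one_right (mul_nonneg hT (Real.rpow_nonneg (Nat.cast_nonneg _) _))
    (by exact_mod_cast hq)

/-- **The rational grid is superfluous**: on a good forecast and for `0 ≤ T`, gathering (more than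
`M` members counting the tagged particle, at SOME grid time) is crowding (at least `M` members of
the backward cluster over the whole window) — backward clusters grow with the final time. -/
theorem isGathering_iff_isCrowded (hT : 0 ≤ T) (hz : ForecastGood σ R N Ψ z i) :
    IsGathering σ T R N Ψ M z i ↔ IsCrowded σ T R N Ψ M z i := by
  constructor
  · rintro ⟨m, q, -, hq1, hM⟩
    rw [card_insert_backwardCluster, Nat.lt_add_one_iff, backwardCluster_forecastWorld hz] at hM
    exact ⟨m, hM.trans (Finset.card_le_card
      (flow_backwardCluster_mono_right (Ψ _) (grid_le hT N hq1)))⟩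
  · rintro ⟨m, hM⟩
    refine ⟨m, 1, zero_le_one, le_rfl, ?_⟩
    rw [card_insert_backwardCluster, Nat.lt_add_one_iff, backwardCluster_forecastWorld hz,
      Rat.cast_one, mul_one]
    exact hM

/-- **Reduction to the number of collisions** (crude): on a good forecast and for `0 ≤ T`, a
gathering forecast world has at least `M` collision times in `(0, Tℓ]`
(`card_insert_backwardCluster_le`). Recorded for completeness only: the mean number of collisions
of the released cluster (`≈ 2√π k T σ² √θ`, `k ≈ 4.2 R³`) exceeds every admissible threshold
`M(R) ≤ √R`. -/
theorem collisions_of_isGathering (hT : 0 ≤ T) (hz : ForecastGood σ R N Ψ z i)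
    (h : IsGathering σ T R N Ψ M z i) :
    M ≤ (collisionWindow G3 (hsDiameter σ N) (forecastWorld σ R N Ψ z i) 0 (T * ell N)).card := by
  obtain ⟨m, hM⟩ := (isGathering_iff_isCrowded hT hz).1 h
  rw [← backwardCluster_forecastWorld hz] at hM
  have := (isHardSphereTrajectory_forecastWorld hz).card_add_recollisionCount_le
    (i := m) (s := 0) (t := T * ell N)
  omega

/-- Crowding is antitone in the threshold. -/
theorem IsCrowded.mono {M' : ℕ} (h : IsCrowded σ T R N Ψ M' z i) (hMM' : M ≤ M') :
    IsCrowded σ T R N Ψ M z i := by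
  obtain ⟨m, hm⟩ := h
  exact ⟨m, hMM'.trans hm⟩

/-! ## § 3 Measurability and the reduction of the gathering probability -/

/-- Case split on the value of the range cluster: an event read through the range cluster of `i`
is measurable as soon as each of its `S`-slices is (`measurableSet_rangeCluster_eq`, countably
many `S`). -/
theorem measurableSet_of_rangeCluster_slices {P : Phase N → Prop}
    (E : Finset (Fin (N + 1)) → Set (Phase N)) (hE : ∀ S, MeasurableSet (E S))
    (hPE : ∀ z, P z ↔ z ∈ E (rangeCluster G3 (R * ell N) z i)) : MeasurableSet {z | P z} := by
  have hset : {z | P z} = ⋃ S, {z : Phase N | rangeCluster G3 (R * ell N) z i = S} ∩ E S := by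
    ext z
    simp only [mem_setOf_eq, mem_iUnion, mem_inter_iff, exists_eq_left', hPE]
  rw [hset]
  exact MeasurableSet.iUnion fun S =>
    (measurableSet_rangeCluster_eq G3 Torus.measurable_geometry_sepVec _ i S).inter (hE S)

/-- The good-forecast event is measurable. -/
theorem measurableSet_forecastGood (σ R : ℝ) (N : ℕ) (Ψ : ClusterFlows σ N) (i : Fin (N + 1)) :
    MeasurableSet {z | ForecastGood σ R N Ψ z i} :=
  measurableSet_of_rangeCluster_slices (fun S => Config.restrictTo S ⁻¹' (Ψ S.card).good)
    (fun S => Config.measurable_restrictTo S (Ψ S.card).measurableSet_good) fun _ => Iff.rfl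

/-- The crowding event is measurable (on the whole phase space). -/
theorem measurableSet_isCrowded (σ T R : ℝ) (N : ℕ) (Ψ : ClusterFlows σ N) (M : ℕ)
    (i : Fin (N + 1)) : MeasurableSet {z | IsCrowded σ T R N Ψ M z i} :=
  measurableSet_of_rangeCluster_slices
    (fun S => Config.restrictTo S ⁻¹'
      {w | ∃ m : Fin S.card, M ≤ ((Ψ S.card).backwardCluster m 0 (T * ell N) w).card})
    (fun S => Config.measurable_restrictTo S (by
      simpa only [setOf_exists] using MeasurableSet.iUnion fun m =>
        measurableSet_backwardCluster_pred (Ψ S.card) m 0 (T * ell N) fun A => M ≤ A.card))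
    fun _ => Iff.rfl

/-- The gathering event CUT DOWN TO GOOD FORECASTS is measurable, for every `T` (countable union
over the grid times `q` and the members `m`; on a good forecast the backward clusters of the
forecast world are the measurable flow versions). -/
theorem measurableSet_forecastGood_and_isGathering (σ T R : ℝ) (N : ℕ) (Ψ : ClusterFlows σ N)
    (M : ℕ) (i : Fin (N + 1)) :
    MeasurableSet {z | ForecastGood σ R N Ψ z i ∧ IsGathering σ T R N Ψ M z i} := by
  refine measurableSet_of_rangeCluster_slices (R := R) (i := i)
    (fun S => Config.restrictTo S ⁻¹' ((Ψ S.card).good ∩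
      {w | ∃ (m : Fin S.card) (q : ℚ), 0 ≤ q ∧ q ≤ 1 ∧
        M < (insert m ((Ψ S.card).backwardCluster m 0 (T * ell N * q) w)).card}))
    (fun S => Config.measurable_restrictTo S ((Ψ S.card).measurableSet_good.inter ?_)) ?_
  · simp only [setOf_exists]
    refine MeasurableSet.iUnion fun m => MeasurableSet.iUnion fun q => ?_
    by_cases hq : 0 ≤ q ∧ q ≤ 1
    · simpa only [hq, true_and] using
        measurableSet_backwardCluster_pred (Ψ S.card) m 0 (T * ell N * q)
          fun A => M < (insert m A).card
    · rw [not_and_or] at hq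
      rcases hq with hq | hq <;> simp [hq]
  · intro z
    simp only [mem_preimage, mem_inter_iff, mem_setOf_eq]
    refine and_congr_right fun hz => ?_
    simp only [IsGathering, backwardCluster_forecastWorld hz]

/-- Under any law charging no bad forecast of `i`, the gathering event is null-measurable. -/
theorem nullMeasurableSet_isGathering {μ : Measure (Phase N)}
    (hgood : ∀ᵐ z ∂μ, ForecastGood σ R N Ψ z i) :
    NullMeasurableSet {z | IsGathering σ T R N Ψ M z i} μ := by
  have hsub : {z | ForecastGood σ R N Ψ z i ∧ IsGathering σ T R N Ψ M z i} ⊆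
      {z | IsGathering σ T R N Ψ M z i} := fun z hz => hz.2
  rw [← Set.union_sdiff_cancel hsub]
  refine (measurableSet_forecastGood_and_isGathering σ T R N Ψ M i).nullMeasurableSet.union
    (NullMeasurableSet.of_null (measure_mono_null (fun z hz => ?_) (ae_iff.1 hgood)))
  exact fun hg => hz.2 ⟨hg, hz.1⟩

/-- **Registered prelim `stub_forecastCapsExist_prelim`** (reduction of the gathering probability):
for `0 ≤ T` and ANY law `μ` on phase space, the probability of gathering is at most that of a bad
forecast plus that of crowding — `{IsGathering} ⊆ {¬ ForecastGood} ∪ {IsCrowded}` by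
`isGathering_iff_isCrowded`. With `μ = G_N` the first term vanishes (stub 1 of the line) and the
second is the grid-free cluster-cardinality tail `ForecastClusterCardTail` (§ 4, OPEN). -/
theorem stub_forecastCapsExist_prelim : ∀ (σ T R : ℝ) (N : ℕ) (Ψ : ClusterFlows σ N) (M : ℕ) (i : Fin (N + 1)) (μ : MeasureTheory.Measure (Phase N)), 0 ≤ T → μ {z | IsGathering σ T R N Ψ M z i} ≤ μ {z | ¬ ForecastGood σ R N Ψ z i} + μ {z | IsCrowded σ T R N Ψ M z i} := by
  intro σ T R N Ψ M i μ hT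
  refine (measure_mono fun z hz => ?_).trans (measure_union_le _ _)
  by_cases hg : ForecastGood σ R N Ψ z i
  · exact Or.inr ((isGathering_iff_isCrowded hT hg).1 hz)
  · exact Or.inl hg

/-! ## § 4 The remaining goal: the grid-free cluster-cardinality tail -/

/-- **The remaining goal of stub 5 (OPEN; not asserted).** The threshold `M(R)` is genuine for
the forecast worlds in the grid-free flow form: uniformly in `i`, `N ≥ N₀(R)`, the true flow and
the cluster flows, the `G_N`-probability that some particle of the forecast world of `i` has a
backward cluster of `≥ M(R)` members over `(0, Tℓ]` tends to `0` as `R → ∞` — a Pulvirenti–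
Simonella cardinality tail, summed over the `≍ R³` members, for the ISOLATED cluster released from
Gibbs data for the microscopic time `Tℓ` (in print only in the Boltzmann–Grad limit). -/
def ForecastClusterCardTail (σ a θ : ℝ) (u₀ : V3) (T : ℝ) (M : ℝ → ℕ) : Prop :=
  ∀ η : ℝ, 0 < η → ∃ R₀ : ℝ, 0 < R₀ ∧ ∀ R : ℝ, R₀ ≤ R → ∃ N₀ : ℕ, ∀ N : ℕ, N₀ ≤ N →
    ∀ (Φ : Flow σ N) (Ψ : ClusterFlows σ N) (i : Fin (N + 1)),
      gibbs σ a θ u₀ N Φ {z | IsCrowded σ T R N Ψ (M R) z i} ≤ ENNReal.ofReal η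

/-- **Transfer**: if bad forecasts are `G_N`-null (stub 1 of the line, in its a.e. form) then the
cluster-cardinality tail gives the gathering tail of the objects module, for `0 ≤ T`. -/
theorem forecastGatheringTail_of_clusterCardTail {σ a θ : ℝ} {u₀ : V3} {T : ℝ} {M : ℝ → ℕ}
    (hT : 0 ≤ T)
    (hgood : ∀ (R : ℝ) (N : ℕ) (Φ : Flow σ N) (Ψ : ClusterFlows σ N) (i : Fin (N + 1)),
      ∀ᵐ z ∂(gibbs σ a θ u₀ N Φ), ForecastGood σ R N Ψ z i)
    (htail : ForecastClusterCardTail σ a θ u₀ T M) : ForecastGatheringTail σ a θ u₀ T M := by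
  intro η hη
  obtain ⟨R₀, hR₀, hR⟩ := htail η hη
  refine ⟨R₀, hR₀, fun R hRR => ?_⟩
  obtain ⟨N₀, hN⟩ := hR R hRR
  refine ⟨N₀, fun N hNN Φ Ψ i => ?_⟩
  calc gibbs σ a θ u₀ N Φ {z | IsGathering σ T R N Ψ (M R) z i}
      ≤ gibbs σ a θ u₀ N Φ {z | ¬ ForecastGood σ R N Ψ z i} +
          gibbs σ a θ u₀ N Φ {z | IsCrowded σ T R N Ψ (M R) z i} :=
        stub_forecastCapsExist_prelim σ T R N Ψ (M R) i _ hT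
    _ = gibbs σ a θ u₀ N Φ {z | IsCrowded σ T R N Ψ (M R) z i} := by
        rw [ae_iff.1 (hgood R N Φ Ψ i), zero_add]
    _ ≤ ENNReal.ofReal η := hN N hNN Φ Ψ i

/-- The cluster-cardinality tail is monotone in the threshold schedule (eventually larger
thresholds are easier). -/
theorem ForecastClusterCardTail.mono {σ a θ : ℝ} {u₀ : V3} {T : ℝ} {M M' : ℝ → ℕ}
    (h : ForecastClusterCardTail σ a θ u₀ T M) {R₁ : ℝ} (hMM' : ∀ R, R₁ ≤ R → M R ≤ M' R) :
    ForecastClusterCardTail σ a θ u₀ T M' := by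
  intro η hη
  obtain ⟨R₀, hR₀, hR⟩ := h η hη
  refine ⟨max R₀ (max R₁ 1), lt_max_of_lt_left hR₀, fun R hRR => ?_⟩
  obtain ⟨N₀, hN⟩ := hR R ((le_max_left _ _).trans hRR)
  refine ⟨N₀, fun N hNN Φ Ψ i => (measure_mono fun z hz => ?_).trans (hN N hNN Φ Ψ i)⟩
  exact IsCrowded.mono hz (hMM' R (((le_max_left _ _).trans (le_max_right _ _)).trans hRR))

/-- **Admissible schedules from real profiles**: if eventually `1 ≤ f(R) ≤ √R` then
`M(R) = ⌊f(R)⌋₊` is an admissible gathering threshold (e.g. `f = √·`, or `f(R) = (log R)^p`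
beyond its crossing with `√R`). -/
theorem admissibleGathering_floor {f : ℝ → ℝ} {Rₐ : ℝ} (hRₐ : 0 < Rₐ)
    (hf : ∀ R, Rₐ ≤ R → 1 ≤ f R ∧ f R ≤ Real.sqrt R) :
    AdmissibleGathering fun R => ⌊f R⌋₊ := by
  refine ⟨Rₐ, hRₐ, fun R hR => ?_⟩
  obtain ⟨h1, h2⟩ := hf R hR
  exact ⟨(Nat.one_le_floor_iff _).2 h1, (Nat.floor_le (zero_le_one.trans h1)).trans h2⟩

/-- The schedule `M(R) = ⌊√R⌋₊` is admissible. -/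
theorem admissibleGathering_sqrt : AdmissibleGathering fun R => ⌊Real.sqrt R⌋₊ :=
  admissibleGathering_floor one_pos fun _ hR => ⟨Real.one_le_sqrt.2 hR, le_rfl⟩

end

end Summit.AtomisticToContinuum.HydrodynamicLimit.Theorems.TrueAnchoredInfection
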